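import Mathlib
import HarnessLib
import Literature.NumberTheory.LFunctions.MuentzFormula
import Literature.Analysis.FunctionSpaces.PlancherelL1L2
import Summits.RiemannHypothesis.RiemannHypothesis.Theorems.IntegerScrewSmoothSectorDefs
import Summits.RiemannHypothesis.RiemannHypothesis.Theorems.ScrewLemmaKCoprofileDefs
import Summits.RiemannHypothesis.RiemannHypothesis.Theorems.ScrewLemmaKCoprofileCalculus

/-!
# Route `ScrewLemmaKCoprofile` — the co-profile as a MÜNTZ SUM: Mellin toolkit for K2
# `CoprofileMoments` (stmt-RiemannHypothesis-21613) and the bridge `CoprofileParseval`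
# (stmt-RiemannHypothesis-22439)

With `Φ_g = latticeCoprofile g`, `F = coprofileDatum g = 1_{(0,1]}·g′(u)/u` and
`G = coprofileDatumSum g = Σ_{n≥1} F(n·)` one has `G(t) = Φ_g(t)/t` for `t > 0` (a finite sum), so
the tree's absolutely convergent Müntz formula
(`Literature.NumberTheory.LFunctions.mellin_tsum_comp_mul_nat`, Titchmarsh 1986 §2.11, `Re s > 1`)
gives the CO-PROFILE MELLIN FORMULA

  `𝓜Φ_g(s − 1) = 𝓜G(s) = ζ(s) · ∫₀¹ g′(u) u^{s−2} du`   (`Re s > 1`, absolutely convergent),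

whenever `g′` is bounded on `(0,1)`.  Consequences proved here:

* `latticeCoprofile_moment` — for real `a ≥ 0`: `∫_{(0,1)} Φ_g(t) t^a dt = Re ζ(a+2) · ∫₀¹ g′(u)u^a du`
  (K2's three moments are `a = 0, 1/2, 1` combined with the generator moments of the Calculus file);
* `latticeCoprofile_parseval_of_memLp` — GIVEN `Φ_g ∈ L²(0,1)`:
  `∫₀¹ Φ_g² = (2π)⁻¹ ∫_ℝ ‖∫₀¹ g′(u)u^{−1/2+iτ} du‖² ‖ζ(3/2+iτ)‖² dτ`, by the tree's Mellin–Plancherel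
  on `Re s = 1/2` (`Literature.Analysis.FunctionSpaces.integral_norm_sq_mellin_half_eq`) and the
  Mellin formula on the line `s = 3/2 + iτ`.

No analytic continuation is used.  Adapted from the rh-idea-5 desk toolkit `CoprofileMellin.lean`
(evidence on item 21613).  RH-free; nothing here bears on the truth of RH.
-/

noncomputable section

set_option linter.dupNamespace false

namespace Summit.RiemannHypothesis.RiemannHypothesis.Theorems.ScrewLemmaKCoprofile

open MeasureTheory Set Filter Complex
open Summit.RiemannHypothesis.RiemannHypothesis.Theorems.IntegerScrew (SmoothSectorAdmissible)

/-! ## T1–T5: the Müntz computation -/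

/-- T1: `G(t) = Φ_g(t)/t` for `t > 0` (the `tsum` is the finite sum over `n + 1 ≤ ⌊1/t⌋`).
[folklore] -/
theorem coprofileDatumSum_eq {g : ℝ → ℝ} {t : ℝ} (ht : 0 < t) :
    coprofileDatumSum g t = ((latticeCoprofile g t : ℝ) : ℂ) / t := by
  unfold coprofileDatumSum latticeCoprofile
  have hsupp : ∀ n ∉ Finset.range ⌊1 / t⌋₊, coprofileDatum g (((n + 1 : ℕ) : ℝ) * t) = 0 := by
    intro n hn
    rw [Finset.mem_range, not_lt] at hn
    apply coprofileDatum_eq_zero_of_one_lt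
    have h1 : 1 / t < (⌊1 / t⌋₊ : ℝ) + 1 := Nat.lt_floor_add_one (1 / t)
    have h2 : (⌊1 / t⌋₊ : ℝ) + 1 ≤ (n : ℝ) + 1 := by exact_mod_cast Nat.add_le_add_right hn 1
    have h3 : 1 / t < (n : ℝ) + 1 := lt_of_lt_of_le h1 h2
    calc (1:ℝ) = (1 / t) * t := by field_simp
      _ < ((n : ℝ) + 1) * t := mul_lt_mul_of_pos_right h3 ht
      _ = ((n + 1 : ℕ) : ℝ) * t := by push_cast; ring
  rw [tsum_eq_sum hsupp, ← Finset.Ico_add_one_right_eq_Icc, Finset.sum_Ico_eq_sum_range,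
    Nat.add_sub_cancel, Complex.ofReal_sum, Finset.sum_div]
  refine Finset.sum_congr rfl fun n hn => ?_
  rw [Finset.mem_range] at hn
  have hle : ((n + 1 : ℕ) : ℝ) * t ≤ 1 := by
    have h3 : ((n + 1 : ℕ) : ℝ) ≤ 1 / t := (Nat.le_floor_iff (by positivity)).mp hn
    calc ((n + 1 : ℕ) : ℝ) * t ≤ (1 / t) * t := mul_le_mul_of_nonneg_right h3 ht.le
      _ = 1 := by field_simp
  have hmem : ((n + 1 : ℕ) : ℝ) * t ∈ Set.Ioc (0:ℝ) 1 := ⟨by positivity, hle⟩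
  rw [coprofileDatum_of_mem hmem]
  have e : ((1 + n : ℕ) : ℝ) = ((n + 1 : ℕ) : ℝ) := by push_cast; ring
  rw [e]
  have hn0 : (((n + 1 : ℕ) : ℝ) : ℂ) ≠ 0 := by exact_mod_cast Nat.succ_ne_zero n
  push_cast
  field_simp

/-- T2: the Mellin transform of the datum `F` converges absolutely for `Re s > 1` when `g′` is
bounded on `(0,1)` (`‖u^{s−1}F(u)‖ ≤ B u^{Re s − 2}` on `(0,1)`, zero beyond). [folklore] -/
theorem mellinConvergent_coprofileDatum {g : ℝ → ℝ} {B : ℝ}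
    (hB : ∀ u ∈ Set.Ioo (0:ℝ) 1, |deriv g u| ≤ B) {s : ℂ} (hs : 1 < s.re) :
    MellinConvergent (coprofileDatum g) s := by
  unfold MellinConvergent
  rw [← Set.Ioc_union_Ioi_eq_Ioi zero_le_one, integrableOn_union]
  constructor
  · rw [integrableOn_Ioc_iff_integrableOn_Ioo]
    have hdom : IntegrableOn (fun u : ℝ => B * u ^ (s.re - 2)) (Set.Ioo 0 1) := by
      have h := (intervalIntegral.intervalIntegrable_rpow' (a := 0) (b := 1) (r := s.re - 2)
        (by linarith))
      rw [intervalIntegrable_iff_integrableOn_Ioo_of_le zero_le_one] at h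
      exact h.const_mul B
    refine hdom.mono' ?_ ?_
    · have h1 : AEStronglyMeasurable (fun u : ℝ => (u : ℂ) ^ (s - 1))
          (volume.restrict (Set.Ioo (0:ℝ) 1)) := by
        refine ContinuousOn.aestronglyMeasurable (fun u hu => ?_) measurableSet_Ioo
        exact (Complex.continuousAt_ofReal_cpow_const u (s - 1)
          (Or.inr hu.1.ne')).continuousWithinAt
      exact h1.smul ((measurable_coprofileDatum g).aestronglyMeasurable)
    · refine (ae_restrict_mem measurableSet_Ioo).mono fun u hu => ?_
      rw [norm_smul, Complex.norm_cpow_eq_rpow_re_of_pos hu.1, norm_coprofileDatum hu,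
        Complex.sub_re, Complex.one_re]
      have hu0 : 0 < u := hu.1
      have e : u ^ (s.re - 1) / u = u ^ (s.re - 2) := by
        rw [← Real.rpow_sub_one hu0.ne']
        ring_nf
      have hr : u ^ (s.re - 1) * (|deriv g u| / u) = |deriv g u| * u ^ (s.re - 2) := by
        rw [← e]
        ring
      rw [hr]
      exact mul_le_mul_of_nonneg_right (hB u hu) (Real.rpow_nonneg hu0.le _)
  · refine (integrableOn_congr_fun (fun u hu => ?_) measurableSet_Ioi).mpr integrableOn_zero
    simp [coprofileDatum_eq_zero_of_one_lt (show (1:ℝ) < u from hu)]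

/-- T3: `𝓜F(s) = ∫₀¹ g′(u) u^{s−2} du` (both sides are the same Bochner integral; no convergence
hypothesis). [folklore] -/
theorem mellin_coprofileDatum (g : ℝ → ℝ) (s : ℂ) :
    mellin (coprofileDatum g) s
      = ∫ u in Set.Ioo (0:ℝ) 1, ((deriv g u : ℝ) : ℂ) * (u : ℂ) ^ (s - 2) := by
  unfold mellin
  rw [setIntegral_eq_of_subset_of_forall_sdiff_eq_zero measurableSet_Ioi Set.Ioc_subset_Ioi_self
    ?_, integral_Ioc_eq_integral_Ioo]
  · refine setIntegral_congr_fun measurableSet_Ioo fun u hu => ?_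
    have hu0 : (u : ℂ) ≠ 0 := Complex.ofReal_ne_zero.mpr hu.1.ne'
    have e : (u : ℂ) ^ (s - 2) = (u : ℂ) ^ (s - 1) / u := by
      rw [show s - 2 = (s - 1) - 1 by ring, Complex.cpow_sub _ _ hu0, Complex.cpow_one]
    rw [coprofileDatum_of_mem (Set.Ioo_subset_Ioc_self hu), smul_eq_mul, e]
    push_cast
    field_simp
  · intro u hu
    have h1 : 1 < u := by
      rcases hu with ⟨h0, hn⟩
      by_contra h
      exact hn ⟨h0, not_lt.mp h⟩
    simp [coprofileDatum_eq_zero_of_one_lt h1]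

/-- T4: Müntz's formula (tree, absolutely convergent case, Titchmarsh 1986 §2.11) applied to the
datum: `𝓜G(s)` converges absolutely and equals `ζ(s)·𝓜F(s)` for `Re s > 1`.
[cite: Titchmarsh1986, §2.11] -/
theorem muentz_coprofileDatumSum {g : ℝ → ℝ} {B : ℝ}
    (hB : ∀ u ∈ Set.Ioo (0:ℝ) 1, |deriv g u| ≤ B) {s : ℂ} (hs : 1 < s.re) :
    MellinConvergent (coprofileDatumSum g) s ∧
      mellin (coprofileDatumSum g) s = riemannZeta s * mellin (coprofileDatum g) s :=
  Literature.NumberTheory.LFunctions.mellin_tsum_comp_mul_nat (coprofileDatum g) hs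
    (mellinConvergent_coprofileDatum hB hs)

/-- T5a: `Φ_g = t • G` on `(0, ∞)`. [folklore] -/
theorem latticeCoprofile_ofReal_eq_cpow_smul {g : ℝ → ℝ} {t : ℝ} (ht : 0 < t) :
    ((latticeCoprofile g t : ℝ) : ℂ) = (t : ℂ) ^ (1 : ℂ) • coprofileDatumSum g t := by
  rw [coprofileDatumSum_eq ht, Complex.cpow_one, smul_eq_mul]
  have ht' : (t : ℂ) ≠ 0 := Complex.ofReal_ne_zero.mpr ht.ne'
  field_simp

/-- T5b: `𝓜Φ_g(s − 1) = 𝓜G(s)` (shift by `mellin_cpow_smul`). [folklore] -/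
theorem mellin_latticeCoprofile_eq_mellin_coprofileDatumSum (g : ℝ → ℝ) (s : ℂ) :
    mellin (fun t => ((latticeCoprofile g t : ℝ) : ℂ)) (s - 1) = mellin (coprofileDatumSum g) s := by
  have h : mellin (fun t => ((latticeCoprofile g t : ℝ) : ℂ)) (s - 1)
      = mellin (fun t => (t : ℂ) ^ (1 : ℂ) • coprofileDatumSum g t) (s - 1) :=
    setIntegral_congr_fun measurableSet_Ioi fun t ht => by
      simp only [latticeCoprofile_ofReal_eq_cpow_smul ht]
  rw [h, mellin_cpow_smul, sub_add_cancel]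

/-- T5c: absolute convergence transfers the same way. [folklore] -/
theorem mellinConvergent_latticeCoprofile_iff (g : ℝ → ℝ) (s : ℂ) :
    MellinConvergent (fun t => ((latticeCoprofile g t : ℝ) : ℂ)) (s - 1) ↔
      MellinConvergent (coprofileDatumSum g) s := by
  have h : MellinConvergent (fun t => ((latticeCoprofile g t : ℝ) : ℂ)) (s - 1)
      ↔ MellinConvergent (fun t => (t : ℂ) ^ (1 : ℂ) • coprofileDatumSum g t) (s - 1) :=
    integrableOn_congr_fun (fun t ht => by simp only [latticeCoprofile_ofReal_eq_cpow_smul ht])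
      measurableSet_Ioi
  rw [h, MellinConvergent.cpow_smul, sub_add_cancel]

/-- **The co-profile Mellin formula** (`Re s > 1`, `g′` bounded on `(0,1)`): `𝓜Φ_g(s−1)` converges
absolutely and equals `ζ(s) ∫₀¹ g′(u) u^{s−2} du` (Müntz, absolutely convergent case).
[cite: Titchmarsh1986, §2.11] -/
theorem mellin_latticeCoprofile_eq {g : ℝ → ℝ} {B : ℝ}
    (hB : ∀ u ∈ Set.Ioo (0:ℝ) 1, |deriv g u| ≤ B) {s : ℂ} (hs : 1 < s.re) :
    MellinConvergent (fun t => ((latticeCoprofile g t : ℝ) : ℂ)) (s - 1) ∧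
      mellin (fun t => ((latticeCoprofile g t : ℝ) : ℂ)) (s - 1)
        = riemannZeta s * ∫ u in Set.Ioo (0:ℝ) 1, ((deriv g u : ℝ) : ℂ) * (u : ℂ) ^ (s - 2) := by
  obtain ⟨h1, h2⟩ := muentz_coprofileDatumSum hB hs
  exact ⟨(mellinConvergent_latticeCoprofile_iff g s).mpr h1,
    by rw [mellin_latticeCoprofile_eq_mellin_coprofileDatumSum, h2, mellin_coprofileDatum]⟩

/-! ## Real moments of the co-profile -/

/-- Real moments through the Mellin formula: for an admissible generator and real `a ≥ 0`,
`∫_{(0,1)} Φ_g(t) t^a dt = Re ζ(a+2) · ∫₀¹ g′(u) u^a du`. [folklore] -/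
theorem latticeCoprofile_moment {g : ℝ → ℝ} (hg : SmoothSectorAdmissible g) {a : ℝ}
    (ha : 0 ≤ a) :
    ∫ t in Set.Ioo (0:ℝ) 1, latticeCoprofile g t * t ^ a
      = (riemannZeta ((a : ℂ) + 2)).re * ∫ u in (0:ℝ)..1, deriv g u * u ^ a := by
  obtain ⟨B, hB⟩ := exists_bound_deriv_Ioo hg.1
  have hs : 1 < ((a : ℂ) + 2).re := by simp; linarith
  obtain ⟨_, hM⟩ := mellin_latticeCoprofile_eq hB hs
  -- left side: the Mellin integral is the real moment
  have hL : mellin (fun t => ((latticeCoprofile g t : ℝ) : ℂ)) ((a : ℂ) + 2 - 1)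
      = (((∫ t in Set.Ioo (0:ℝ) 1, latticeCoprofile g t * t ^ a) : ℝ) : ℂ) := by
    unfold mellin
    rw [setIntegral_eq_of_subset_of_forall_sdiff_eq_zero measurableSet_Ioi Set.Ioc_subset_Ioi_self
      ?_, integral_Ioc_eq_integral_Ioo, ← integral_complex_ofReal]
    · refine setIntegral_congr_fun measurableSet_Ioo fun t ht => ?_
      rw [show (a : ℂ) + 2 - 1 - 1 = (a : ℂ) by ring, ← Complex.ofReal_cpow ht.1.le, smul_eq_mul]
      push_cast
      ring
    · intro t ht
      have h1 : 1 < t := by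
        rcases ht with ⟨h0, hn⟩
        by_contra h
        exact hn ⟨h0, not_lt.mp h⟩
      simp [latticeCoprofile_eq_zero_of_one_lt h1]
  -- right side: the generator integral is real
  have hR : (∫ u in Set.Ioo (0:ℝ) 1, ((deriv g u : ℝ) : ℂ) * (u : ℂ) ^ ((a : ℂ) + 2 - 2))
      = (((∫ u in (0:ℝ)..1, deriv g u * u ^ a) : ℝ) : ℂ) := by
    rw [intervalIntegral.integral_of_le zero_le_one, integral_Ioc_eq_integral_Ioo,
      ← integral_complex_ofReal]
    refine setIntegral_congr_fun measurableSet_Ioo fun u hu => ?_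
    rw [show (a : ℂ) + 2 - 2 = (a : ℂ) by ring, ← Complex.ofReal_cpow hu.1.le]
    push_cast
    ring
  rw [hL, hR] at hM
  -- `ζ(a+2)` is real on the real axis
  have hz : riemannZeta ((a : ℂ) + 2) = (((riemannZeta ((a : ℂ) + 2)).re : ℝ) : ℂ) := by
    have hreal : (starRingEnd ℂ) ((a : ℂ) + 2) = (a : ℂ) + 2 := by
      apply Complex.ext <;> simp
    have h := riemannZeta_conj ((a : ℂ) + 2)
    rw [hreal] at h
    exact (Complex.conj_eq_iff_re.mp h.symm).symm
  rw [hz] at hM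
  exact_mod_cast hM

/-! ## Co-profile Parseval, given square-integrability -/

/-- **Co-profile Parseval** from the Mellin formula on the line `s = 3/2 + iτ` and the tree's
Mellin–Plancherel at `Re = 1/2`, GIVEN `Φ_g ∈ L²(0,1)` (which is K2 (i)):
`∫₀¹ Φ_g² = (2π)⁻¹ ∫_ℝ ‖∫₀¹ g′(u)u^{−1/2+iτ} du‖² ‖ζ(3/2+iτ)‖² dτ`. [folklore] -/
theorem latticeCoprofile_parseval_of_memLp {g : ℝ → ℝ} {B : ℝ}
    (hB : ∀ u ∈ Set.Ioo (0:ℝ) 1, |deriv g u| ≤ B)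
    (hL2 : MemLp (latticeCoprofile g) 2 (volume.restrict (Set.Ioo (0:ℝ) 1))) :
    (∫ t in Set.Ioo (0:ℝ) 1, (latticeCoprofile g t) ^ 2)
      = (1 / (2 * Real.pi)) * ∫ t : ℝ, ‖∫ u in Set.Ioo (0:ℝ) 1, ((deriv g u : ℝ) : ℂ)
          * (u : ℂ) ^ (-(1 / 2 : ℂ) + t * Complex.I)‖ ^ 2
            * ‖riemannZeta (3 / 2 + t * Complex.I)‖ ^ 2 := by
  set Φc : ℝ → ℂ := fun t => ((latticeCoprofile g t : ℝ) : ℂ) with hΦc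
  -- (I) absolute convergence at 1/2
  have hI : MellinConvergent Φc (1 / 2 : ℂ) := by
    have h := (mellin_latticeCoprofile_eq hB (s := (3 / 2 : ℂ)) (by norm_num)).1
    rw [show (3 / 2 : ℂ) - 1 = 1 / 2 by norm_num] at h
    exact h
  -- (II) square integrability on (0, ∞)
  have hsq : ∀ t : ℝ, ‖Φc t‖ ^ 2 = (latticeCoprofile g t) ^ 2 := fun t => by
    simp only [hΦc, Complex.norm_real, Real.norm_eq_abs, sq_abs]
  have hII : IntegrableOn (fun t => ‖Φc t‖ ^ 2) (Set.Ioi 0) := by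
    rw [← Set.Ioc_union_Ioi_eq_Ioi zero_le_one, integrableOn_union]
    constructor
    · rw [integrableOn_Ioc_iff_integrableOn_Ioo]
      exact hL2.integrable_sq.congr (Eventually.of_forall fun t => (hsq t).symm)
    · refine (integrableOn_congr_fun (fun t ht => ?_) measurableSet_Ioi).mpr integrableOn_zero
      simp [hΦc, latticeCoprofile_eq_zero_of_one_lt (show (1:ℝ) < t from ht)]
  -- (III) Mellin–Plancherel (tree)
  obtain ⟨_, hP⟩ := Literature.Analysis.FunctionSpaces.integral_norm_sq_mellin_half_eq hI hII
  -- (IV) the transform on the line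
  have hIV : ∀ τ : ℝ, mellin Φc (1 / 2 + τ * I) = riemannZeta (3 / 2 + τ * I)
      * ∫ u in Set.Ioo (0:ℝ) 1, ((deriv g u : ℝ) : ℂ) * (u : ℂ) ^ (-(1 / 2 : ℂ) + τ * I) := by
    intro τ
    have h := (mellin_latticeCoprofile_eq hB (s := 3 / 2 + τ * I) (by simp; norm_num)).2
    have e1 : (3 / 2 + τ * I : ℂ) - 1 = 1 / 2 + τ * I := by ring
    have e2 : (3 / 2 + τ * I : ℂ) - 2 = -(1 / 2 : ℂ) + τ * I := by ring
    rw [e1, e2] at h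
    exact h
  -- (V) bookkeeping
  have hV : ∫ t in Set.Ioi 0, ‖Φc t‖ ^ 2 = ∫ t in Set.Ioo (0:ℝ) 1, (latticeCoprofile g t) ^ 2 := by
    rw [setIntegral_eq_of_subset_of_forall_sdiff_eq_zero measurableSet_Ioi Set.Ioc_subset_Ioi_self
      ?_, integral_Ioc_eq_integral_Ioo]
    · exact setIntegral_congr_fun measurableSet_Ioo fun t _ => hsq t
    · intro t ht
      have h1 : 1 < t := by
        rcases ht with ⟨h0, hn⟩
        by_contra h
        exact hn ⟨h0, not_lt.mp h⟩
      simp [hΦc, latticeCoprofile_eq_zero_of_one_lt h1]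
  have hP' : ∫ τ : ℝ, ‖∫ u in Set.Ioo (0:ℝ) 1, ((deriv g u : ℝ) : ℂ)
      * (u : ℂ) ^ (-(1 / 2 : ℂ) + τ * I)‖ ^ 2 * ‖riemannZeta (3 / 2 + τ * I)‖ ^ 2
        = 2 * Real.pi * ∫ t in Set.Ioo (0:ℝ) 1, (latticeCoprofile g t) ^ 2 := by
    rw [← hV, ← hP]
    refine integral_congr_ae (Eventually.of_forall fun τ => ?_)
    simp only [hIV τ, norm_mul, mul_pow]
    ring
  rw [hP']
  have h2π : (2 * Real.pi) ≠ 0 := by positivity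
  field_simp

/-- The weighted boundary energy `τ ↦ ‖∫₀¹ g′(u)u^{−1/2+iτ} du‖² ‖ζ(3/2+iτ)‖²` IS integrable
once `Φ_g ∈ L²(0,1)` (it is the Mellin–Plancherel integrand `‖𝓜Φ_g(1/2+iτ)‖²`), so the Parseval
right-hand side is an honest Bochner integral. [folklore] -/
theorem integrable_boundaryEnergy_of_memLp {g : ℝ → ℝ} {B : ℝ}
    (hB : ∀ u ∈ Set.Ioo (0:ℝ) 1, |deriv g u| ≤ B)
    (hL2 : MemLp (latticeCoprofile g) 2 (volume.restrict (Set.Ioo (0:ℝ) 1))) :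
    Integrable (fun t : ℝ => ‖∫ u in Set.Ioo (0:ℝ) 1, ((deriv g u : ℝ) : ℂ)
        * (u : ℂ) ^ (-(1 / 2 : ℂ) + t * Complex.I)‖ ^ 2
          * ‖riemannZeta (3 / 2 + t * Complex.I)‖ ^ 2) := by
  set Φc : ℝ → ℂ := fun t => ((latticeCoprofile g t : ℝ) : ℂ) with hΦc
  have hI : MellinConvergent Φc (1 / 2 : ℂ) := by
    have h := (mellin_latticeCoprofile_eq hB (s := (3 / 2 : ℂ)) (by norm_num)).1
    rw [show (3 / 2 : ℂ) - 1 = 1 / 2 by norm_num] at h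
    exact h
  have hsq : ∀ t : ℝ, ‖Φc t‖ ^ 2 = (latticeCoprofile g t) ^ 2 := fun t => by
    simp only [hΦc, Complex.norm_real, Real.norm_eq_abs, sq_abs]
  have hII : IntegrableOn (fun t => ‖Φc t‖ ^ 2) (Set.Ioi 0) := by
    rw [← Set.Ioc_union_Ioi_eq_Ioi zero_le_one, integrableOn_union]
    constructor
    · rw [integrableOn_Ioc_iff_integrableOn_Ioo]
      exact hL2.integrable_sq.congr (Eventually.of_forall fun t => (hsq t).symm)
    · refine (integrableOn_congr_fun (fun t ht => ?_) measurableSet_Ioi).mpr integrableOn_zero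
      simp [hΦc, latticeCoprofile_eq_zero_of_one_lt (show (1:ℝ) < t from ht)]
  obtain ⟨hint, _⟩ := Literature.Analysis.FunctionSpaces.integral_norm_sq_mellin_half_eq hI hII
  have hIV : ∀ τ : ℝ, mellin Φc (1 / 2 + τ * I) = riemannZeta (3 / 2 + τ * I)
      * ∫ u in Set.Ioo (0:ℝ) 1, ((deriv g u : ℝ) : ℂ) * (u : ℂ) ^ (-(1 / 2 : ℂ) + τ * I) := by
    intro τ
    have h := (mellin_latticeCoprofile_eq hB (s := 3 / 2 + τ * I) (by simp; norm_num)).2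
    have e1 : (3 / 2 + τ * I : ℂ) - 1 = 1 / 2 + τ * I := by ring
    have e2 : (3 / 2 + τ * I : ℂ) - 2 = -(1 / 2 : ℂ) + τ * I := by ring
    rw [e1, e2] at h
    exact h
  refine hint.congr (Eventually.of_forall fun τ => ?_)
  simp only [hIV τ, norm_mul, mul_pow]
  ring

end Summit.RiemannHypothesis.RiemannHypothesis.Theorems.ScrewLemmaKCoprofile

end
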